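import Mathlib
import Summits.NavierStokesRegularity.NavierStokesRegularity.Theorems.TaoLadderRungTwoFlatConditionalBlock
import Summits.NavierStokesRegularity.NavierStokesRegularity.Theorems.TaoLadderRungTwoFlatCapturePhase
import Summits.NavierStokesRegularity.NavierStokesRegularity.Theorems.TaoLadderRungTwoFlatCaptureDevProfile
import HarnessLib

/-!
# THE CAPTURE HOP FROM A CONDITIONAL BLOCK ENCLOSURE, IN ONE CALL — clock, envelope and capture obligations at a hop
  `n + 1 ≤ N₀`, and the K4 capture-type bound at `n ≤ N₀`
  (helper for the K_A♭ parent item stmt-NavierStokesRegularity-22987 `FlatGapCertificatesV2`, route TaoLadderRungTwoFlat;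
  cell harvest/h2-tao-ladder, p1 g25; the row list theory-1's CAPTURE-E2-70 producer fills (LADDER §69–§70, A-132, A70-1/2/3))

* `captureHop_of_block` — `TubeStepClockWith ∧ TubeStepEnvelopeWith ∧ TubeStepCaptureWith` at hop `n` (`n + 1 ≤ N₀`) for the
  choice rule, from: the CONDITIONAL block row of `…ConditionalBlock` (block `[k_L, k_H+1]`, boxes `±4G_{k_H+1}` / `±2ℓ_b`),
  the checkpoint state vanishing below the block, the block-bottom level and its closing inequality (`ι = η(n) + r`), the
  zero-padded reference with its plain hull `M_Z` and profile `D_k ≤ D` (`D_k ≥ ℓ_b` below, `≥ 2G_{k_H+1}` beyond), the per-hop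
  window `[t_lo, t_hi] ⊆ (0, c₀]` of good times, and the reference rows: carrier `(1+σ)f + D₁ ≤ |Z_{i₀1}|` and capture mismatch
  `ρ` on the window with the budget `D(1/f + M_Z/(A_* f²)) + ρ ≤ η(n+1)`, envelope rows `½(|Z_k| + D)² ≤ env₀(k)` (`k ≤ k_H+1`),
  ahead window rows `8w_k(|Z_{1+k}| + D_{1+k}) ≤ r·AFL`, hull `|Z₁(k_H+1)| + D ≤ V_top`, and the cut schedule `G`, `Ω` with its
  closing inequalities (`initialTail_le_of_clauses` and `init_below_of_captureClause` discharge the state-level inputs);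
* `capB_of_block` — the K4 input `hcapB` at a hop `n ≤ N₀`: a uniform `ω`-bound of the kick-ball states of `H(n)` and of all
  their short flows, from the same block data along the short flows (`devProfile_of_conditionalBlock_ball`) and the weight rows
  `ω ≤ Ω_w·w`, `ω ≤ Ω_K` below `k₁`, `ω_k|Z_k| ≤ M_Z^ω`, `ω_k D_k ≤ D^Ω`.

HONEST FRAMING: composition only, over the cell's typed frame (MODEL lattice); the conditional block row and every reference row are
BOOKED HYPOTHESES (theory-1's validated enclosure is not a kernel object); nothing certified; no item closed; nothing about the
Navier–Stokes equations.
-/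

noncomputable section

-- the sub-problem namespace repeats the summit name by design (D-0017)
set_option linter.dupNamespace false

namespace Summit.NavierStokesRegularity.NavierStokesRegularity.Theorems.HopTube

open Set Finset Filter Topology Literature.Analysis.FluidPDE Literature.Analysis.FluidPDE.TaoCascade MirrorPulse RenormFrame QuadPolar

section Block

variable {ε ε₀ : ℝ}

set_option maxHeartbeats 800000 in
/-- **THE CAPTURE HOP FROM A CONDITIONAL BLOCK ENCLOSURE.** See the module docstring for the row list.
[cite: Tao2016AveragedNS, §4 Lemma 4.1, §5, §6.2 Prop. 6.3 (ix), §6.3–6.4 Props. 6.4–6.5 (statement shape); cell LADDER §50, §62, §69–§70 (CAPTURE-69, CAPTURE-E2-70, A-132, A70-1/2/3)] -/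
theorem captureHop_of_block (P : TubeSchedule) {Bcl : ℕ → (Fin 2 → ℤ → ℝ) → Prop} {σ : ℝ} {i₀ : Fin 2}
    {X₀ : Fin 2 → ℝ} {w : ℤ → ℝ} {r θ₀ c₀ t₀ : ℝ} {ζ : ℕ → Fin 2 → ℤ → ℝ} {ustar : Fin 2 → ℤ → ℝ}
    {good : ℕ → (Fin 2 → ℤ → ℝ → ℝ) → ℝ → Prop} {n : ℕ}
    (hε : 0 ≤ ε) (hε₀ : 0 < ε₀) (hn : n + 1 ≤ P.N₀) (hc₀ : 0 < c₀)
    (hζ0 : ζ 0 = datumState i₀ X₀) (hη0 : 0 ≤ P.η 0) (hk₁ : 1 ≤ P.k₁) (hr0 : 0 ≤ r)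
    (hw1 : ∀ k, 1 ≤ w k) (hAstar : 0 < P.Astar) (hθ₀ : 0 ≤ θ₀) (hθ₀1 : θ₀ ≤ 1) (hAFL : 0 < 1 - θ₀ * ε₀)
    (hσ : 0 ≤ σ) (hσA : 1 + σ ≤ P.Astar)
    -- THE BLOCK `[k_L, k_H + 1]`: conditional enclosure row, checkpoint support, block-bottom level, closing inequality
    {kL kH : ℤ} {Z : Fin 2 → ℤ → ℝ → ℝ} {Dk G Ω env₀ : ℤ → ℝ} {MZ D ℓb BL Vtop ρ : ℝ}
    (hLB : kL ≤ kH + 1) (hk₁H : (P.k₁ : ℤ) ≤ kH + 2) (hGpos : 0 < G (kH + 1)) (hℓb : 0 < ℓb) (hBL : 0 ≤ BL)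
    (hVtop : 0 ≤ Vtop)
    (hblock : ∀ z S₀ s S F, InTubeWith P Bcl i₀ X₀ w r ζ ustar n z → (∀ i k, w k * |S₀ i k - z i k| ≤ r) → 0 < s →
      PseudoFlowOnShift shiftSetFlat s ε₀ (mirrorTable ε ε) 0 0 S₀ (fun i k => (1 / 2) * S₀ i k ^ 2) (fun _ _ => 0) S F →
        ∀ t ∈ Icc 0 c₀, t ≤ s →
          (∀ s' ∈ Icc 0 t, ∀ i : Fin 2,
              |S i (kH + 1 + 1) s'| ≤ 4 * G (kH + 1) ∧ ∀ k : ℤ, k < kL → |S i k s'| ≤ 2 * ℓb) →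
            ∀ s' ∈ Icc 0 t, ∀ (i : Fin 2) (k : ℤ), kL ≤ k → k ≤ kH + 1 → |S i k s' - Z i k s'| ≤ Dk k)
    (hζb : ∀ (i : Fin 2) (k : ℤ), k < kL → ζ n i k = 0)
    (hBLrow : ∀ s ∈ Icc 0 c₀, ∀ i : Fin 2, |Z i kL s| + Dk kL ≤ BL)
    (hcloseB : P.η n + r + c₀ * clockW ε₀ (kL - 1) * tableAbsSum shiftSetFlat (mirrorTable ε ε) * max (2 * ℓb) BL ^ 2 ≤ ℓb)
    -- the ZERO-PADDED reference: plain hull, profile `D_k ≤ D` dominating the levels off the block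
    (hZb : ∀ (i : Fin 2) (k : ℤ) (s : ℝ), k < kL → Z i k s = 0)
    (hZa : ∀ (i : Fin 2) (k : ℤ) (s : ℝ), kH + 1 < k → Z i k s = 0)
    (hDb : ∀ k : ℤ, k < kL → ℓb ≤ Dk k) (hDa : ∀ k : ℤ, kH + 1 < k → 2 * G (kH + 1) ≤ Dk k) (hDk : ∀ k, Dk k ≤ D)
    (hZp : ∀ i k, ∀ t ∈ Icc 0 c₀, |Z i k t| ≤ MZ)
    -- good section times in the per-hop window `[t_lo, t_hi] ⊆ (0, c₀]`
    {tlo thi : ℝ} (htlo : 0 < tlo)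
    (hex : ∀ z S₀ τ S F, HopPremiseWith P Bcl shiftSetFlat ε₀ i₀ (mirrorTable ε ε) X₀ w r c₀ ζ ustar n z S₀ τ S F →
      ∃ t, good n S t)
    (hwin : ∀ z S₀ τ S F, HopPremiseWith P Bcl shiftSetFlat ε₀ i₀ (mirrorTable ε ε) X₀ w r c₀ ζ ustar n z S₀ τ S F →
      ∀ t, good n S t → tlo ≤ t ∧ t ≤ thi) (hthi : thi ≤ c₀)
    -- reference rows: carrier, capture mismatch + budget, envelope, ahead window + hull, cut schedule
    (hrefC : ∀ t ∈ Icc tlo thi, (1 + σ) * (1 + ε₀) ^ (-θ₀) + Dk 1 ≤ |Z i₀ 1 t|)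
    (href : ∀ t ∈ Icc tlo thi, ∀ (i : Fin 2) (k : ℤ),
      |Z i (1 + k) t / clampedRatio P i₀ ε₀ θ₀ t Z - ζ (n + 1) i k| ≤ ρ)
    (hbudget : D * (1 / (1 + ε₀) ^ (-θ₀) + MZ / (P.Astar * ((1 + ε₀) ^ (-θ₀)) ^ 2)) + ρ ≤ P.η (n + 1))
    (hG0 : ∀ j, kH < j → 0 ≤ G j)
    (hrefE : ∀ s ∈ Icc 0 c₀, ∀ (i : Fin 2) (k : ℤ), k ≤ kH + 1 → (1 / 2) * (|Z i k s| + D) ^ 2 ≤ env₀ k)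
    (hrefA : ∀ t ∈ Icc tlo thi, ∀ (i : Fin 2) (k : ℤ), (P.k₁ : ℤ) ≤ k → k ≤ kH →
      8 * (w k * (|Z i (1 + k) t| + Dk (1 + k))) ≤ r * (1 - θ₀ * ε₀))
    (hrefV : ∀ t ∈ Icc 0 c₀, |Z 1 (kH + 1) t| + D ≤ Vtop)
    (hΩ : ∀ j, kH < j → ∀ N : Finset ℤ, (∀ m ∈ N, j < m) → ∑ m ∈ N, (w m)⁻¹ ^ 2 ≤ Ω j)
    (hGΩ : ∀ j, kH < j → 2 * (9 / 8 * r) ^ 2 * Ω j ≤ G j ^ 2)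
    (hclose0 : 4 / 3 * c₀ * clock ε₀ (kH + 1) * Vtop * (Vtop + 2 * ε * G (kH + 1)) < G (kH + 1))
    (hcloseG : ∀ j, kH + 1 ≤ j →
      4 / 3 * c₀ * clock ε₀ (j + 1) * (2 * G j) * (2 * G j + 2 * ε * G (j + 1)) < G (j + 1))
    (hGr : ∀ k, kH < k → 8 * (w k * (2 * G k)) ≤ r * (1 - θ₀ * ε₀))
    (henvA : ∀ m : ℤ, kH + 1 < m → 2 * G (m - 1) ^ 2 ≤ env₀ m) :
    TubeStepClockWith P Bcl (choiceRule P i₀ ε₀ θ₀ t₀ good) shiftSetFlat σ ε₀ i₀ (mirrorTable ε ε) X₀ w r θ₀ c₀ ζ ustar n ∧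
      TubeStepEnvelopeWith P Bcl (choiceRule P i₀ ε₀ θ₀ t₀ good) shiftSetFlat ε₀ i₀ (mirrorTable ε ε) X₀ w r c₀ env₀ ζ
        ustar n ∧
      TubeStepCaptureWith P Bcl (choiceRule P i₀ ε₀ θ₀ t₀ good) shiftSetFlat ε₀ i₀ (mirrorTable ε ε) X₀ w r c₀ ζ ustar n := by
  have hε' : (-1 : ℝ) < ε₀ := by linarith
  have hw0 : ∀ k, 0 < w k := fun k => lt_of_lt_of_le one_pos (hw1 k)
  -- state-level inputs below and beyond the block, from the clauses of `H(n)`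
  have hι : ∀ z S₀ : Fin 2 → ℤ → ℝ, InTubeWith P Bcl i₀ X₀ w r ζ ustar n z → (∀ i k, w k * |S₀ i k - z i k| ≤ r) →
      ∀ (i : Fin 2) (k : ℤ), k < kL → |S₀ i k| ≤ P.η n + r := fun z S₀ hz hkick =>
    init_below_of_captureClause P (capture_of_inTubeWith_le P (by omega) hζ0 hη0 hk₁ hr0 hz).1 hζb hw1 hkick
  have hinit : ∀ z S₀ : Fin 2 → ℤ → ℝ, InTubeWith P Bcl i₀ X₀ w r ζ ustar n z → (∀ i k, w k * |S₀ i k - z i k| ≤ r) →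
      ∀ N : Finset ℤ, (∀ m ∈ N, kH + 1 < m) → ∑ m ∈ N, ∑ i : Fin 2, S₀ i m ^ 2 ≤ G (kH + 1) ^ 2 :=
    fun z S₀ hz hkick N hN =>
      (initialTail_le_of_clauses P hw0 hr0 (capture_of_inTubeWith_le P (by omega) hζ0 hη0 hk₁ hr0 hz).2 hkick
        (j := kH + 1) (by omega) hN (hΩ (kH + 1) (by omega) N hN)).trans (hGΩ (kH + 1) (by omega))
  have hrefV' : ∀ t ∈ Icc 0 c₀, |Z 1 (kH + 1) t| + Dk (kH + 1) ≤ Vtop := fun t ht => by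
    linarith [hrefV t ht, hDk (kH + 1)]
  -- the deviation profile of every premise (the interface bootstrap of `…ConditionalBlock`)
  have hdevk := devProfile_of_conditionalBlock P hε hε₀ hc₀ hLB hGpos hℓb hVtop hBL hblock hrefV' hinit hclose0 hι hBLrow
    hcloseB hZb hZa hDb hDa
  have hdev : ∀ z S₀ τ S F, HopPremiseWith P Bcl shiftSetFlat ε₀ i₀ (mirrorTable ε ε) X₀ w r c₀ ζ ustar n z S₀ τ S F →
      ∀ (i : Fin 2) (k : ℤ), ∀ s ∈ Icc 0 c₀, |S i k s - Z i k s| ≤ D :=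
    fun z S₀ τ S F h i k s hs => (hdevk z S₀ τ S F h i k s hs).trans (hDk k)
  have hwin' : ∀ z S₀ τ S F, HopPremiseWith P Bcl shiftSetFlat ε₀ i₀ (mirrorTable ε ε) X₀ w r c₀ ζ ustar n z S₀ τ S F →
      ∀ t, good n S t → tlo ≤ t ∧ t ≤ c₀ :=
    fun z S₀ τ S F h t ht => ⟨(hwin z S₀ τ S F h t ht).1, (hwin z S₀ τ S F h t ht).2.trans hthi⟩
  refine ⟨?_, ?_, ?_⟩
  · refine tubeStepClockWith_of_carrier P hε' hσ hσA hex
      (fun z S₀ τ S F h t ht => ⟨htlo.trans_le (hwin' z S₀ τ S F h t ht).1, (hwin' z S₀ τ S F h t ht).2⟩)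
      fun z S₀ τ S F h t ht => ?_
    obtain ⟨h1, h2⟩ := hwin z S₀ τ S F h t ht
    have hd := hdevk z S₀ τ S F h i₀ 1 t ⟨htlo.le.trans h1, h2.trans hthi⟩
    have := abs_sub_abs_le_abs_sub (Z i₀ 1 t) (S i₀ 1 t)
    rw [abs_sub_comm] at hd
    linarith [hrefC t ⟨h1, h2⟩]
  · exact tubeStepEnvelopeWith_of_continuity P hε hε₀ (by omega) hc₀ hζ0 hη0 hk₁ hr0 hw1 hdev hex hwin' hk₁H hVtop hG0
      hrefE hrefV hΩ hGΩ hclose0 hcloseG henvA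
  · exact tubeStepCaptureWith_of_devProfile P hε hε₀ hn hc₀ hζ0 hη0 hk₁ hr0 hw1 hAstar hθ₀ hθ₀1 hAFL hZp hDk hdevk htlo
      hex hwin hthi href hbudget hk₁H hVtop hG0 hrefA hrefV' hΩ hGΩ hclose0 hcloseG hGr

/-- **THE K4 CAPTURE-TYPE BOUND AT A HOP `n ≤ N₀` FROM THE BLOCK** (the input `hcapB` of `tubeExistWith_of_phases`): a uniform
`ω`-bound of the kick-ball states of `H(n)` and of all their short flows, from the conditional block row along the short flows,
the zero-padded reference with `ω_k|Z_k| ≤ M_Z^ω`, `ω_k D_k ≤ D^Ω`, and the weight rows `ω ≤ Ω_w w`, `ω ≤ Ω_K` below `k₁`.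
[cite: Tao2016AveragedNS, §4 Lemma 4.1 (4.5) (statement shape); cell LADDER §47.5 L2 (K4), §70 (A70-3)] -/
theorem capB_of_block (P : TubeSchedule) {Bcl : ℕ → (Fin 2 → ℤ → ℝ) → Prop} {i₀ : Fin 2}
    {X₀ : Fin 2 → ℝ} {w ω : ℤ → ℝ} {r c₀ : ℝ} {ζ : ℕ → Fin 2 → ℤ → ℝ} {ustar : Fin 2 → ℤ → ℝ} {n : ℕ}
    (hε : 0 ≤ ε) (hε₀ : 0 < ε₀) (hn : n ≤ P.N₀)
    (hζ0 : ζ 0 = datumState i₀ X₀) (hη0 : 0 ≤ P.η 0) (hk₁ : 1 ≤ P.k₁) (hr0 : 0 ≤ r) (hw1 : ∀ k, 1 ≤ w k)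
    {kL kB : ℤ} {Z : Fin 2 → ℤ → ℝ → ℝ} {Dk : ℤ → ℝ} {G ℓb BL Vtop Ω₁ : ℝ}
    (hLB : kL ≤ kB) (hk₁B : (P.k₁ : ℤ) ≤ kB + 1) (hGpos : 0 < G) (hℓb : 0 < ℓb) (hBL : 0 ≤ BL) (hVtop : 0 ≤ Vtop)
    (hblock : ∀ z S₀ s S F, InTubeWith P Bcl i₀ X₀ w r ζ ustar n z → (∀ i k, w k * |S₀ i k - z i k| ≤ r) → 0 < s →
      PseudoFlowOnShift shiftSetFlat s ε₀ (mirrorTable ε ε) 0 0 S₀ (fun i k => (1 / 2) * S₀ i k ^ 2) (fun _ _ => 0) S F →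
        ∀ t ∈ Icc 0 c₀, t ≤ s →
          (∀ s' ∈ Icc 0 t, ∀ i : Fin 2, |S i (kB + 1) s'| ≤ 4 * G ∧ ∀ k : ℤ, k < kL → |S i k s'| ≤ 2 * ℓb) →
            ∀ s' ∈ Icc 0 t, ∀ (i : Fin 2) (k : ℤ), kL ≤ k → k ≤ kB → |S i k s' - Z i k s'| ≤ Dk k)
    (hζb : ∀ (i : Fin 2) (k : ℤ), k < kL → ζ n i k = 0)
    (hVt : ∀ s ∈ Icc 0 c₀, |Z 1 kB s| + Dk kB ≤ Vtop)
    (hΩ₁ : ∀ N : Finset ℤ, (∀ m ∈ N, kB < m) → ∑ m ∈ N, (w m)⁻¹ ^ 2 ≤ Ω₁) (hGΩ₁ : 2 * (9 / 8 * r) ^ 2 * Ω₁ ≤ G ^ 2)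
    (hcloseA : 4 / 3 * c₀ * clock ε₀ kB * Vtop * (Vtop + 2 * ε * G) < G)
    (hBLrow : ∀ s ∈ Icc 0 c₀, ∀ i : Fin 2, |Z i kL s| + Dk kL ≤ BL)
    (hcloseB : P.η n + r + c₀ * clockW ε₀ (kL - 1) * tableAbsSum shiftSetFlat (mirrorTable ε ε) * max (2 * ℓb) BL ^ 2 ≤ ℓb)
    (hZb : ∀ (i : Fin 2) (k : ℤ) (s : ℝ), k < kL → Z i k s = 0) (hZa : ∀ (i : Fin 2) (k : ℤ) (s : ℝ), kB < k → Z i k s = 0)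
    (hDb : ∀ k : ℤ, k < kL → ℓb ≤ Dk k) (hDa : ∀ k : ℤ, kB < k → 2 * G ≤ Dk k)
    -- weight rows
    {Ωw ΩK Mζ MZω DΩ : ℝ} (hω0 : ∀ k, 0 ≤ ω k) (hΩw : 0 ≤ Ωw) (hωw : ∀ k, ω k ≤ Ωw * w k) (hΩK : 0 ≤ ΩK)
    (hωK : ∀ k, k < (P.k₁ : ℤ) → ω k ≤ ΩK) (hMζ : ∀ (i : Fin 2) (k : ℤ), k < (P.k₁ : ℤ) → |ζ n i k| ≤ Mζ)
    (hZω : ∀ i k, ∀ t ∈ Icc 0 c₀, ω k * |Z i k t| ≤ MZω) (hωD : ∀ k, ω k * Dk k ≤ DΩ) :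
    ∃ Bn : ℝ, ∀ z S₀ : Fin 2 → ℤ → ℝ, InTubeWith P Bcl i₀ X₀ w r ζ ustar n z → (∀ i k, w k * |S₀ i k - z i k| ≤ r) →
      (∀ (i : Fin 2) (k : ℤ), ω k * |S₀ i k| ≤ Bn) ∧
        ∀ s : ℝ, 0 < s → s ≤ c₀ → ∀ S F : Fin 2 → ℤ → ℝ → ℝ,
          PseudoFlowOnShift shiftSetFlat s ε₀ (mirrorTable ε ε) 0 0 S₀ (fun i k => (1 / 2) * S₀ i k ^ 2) (fun _ _ => 0) S F →
            ∀ t ∈ Icc 0 s, ∀ (i : Fin 2) (k : ℤ), ω k * |S i k t| ≤ Bn := by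
  have hw0 : ∀ k, 0 < w k := fun k => lt_of_lt_of_le one_pos (hw1 k)
  have hι : ∀ z S₀ : Fin 2 → ℤ → ℝ, InTubeWith P Bcl i₀ X₀ w r ζ ustar n z → (∀ i k, w k * |S₀ i k - z i k| ≤ r) →
      ∀ (i : Fin 2) (k : ℤ), k < kL → |S₀ i k| ≤ P.η n + r := fun z S₀ hz hkick =>
    init_below_of_captureClause P (capture_of_inTubeWith_le P hn hζ0 hη0 hk₁ hr0 hz).1 hζb hw1 hkick
  have hinit : ∀ z S₀ : Fin 2 → ℤ → ℝ, InTubeWith P Bcl i₀ X₀ w r ζ ustar n z → (∀ i k, w k * |S₀ i k - z i k| ≤ r) →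
      ∀ N : Finset ℤ, (∀ m ∈ N, kB < m) → ∑ m ∈ N, ∑ i : Fin 2, S₀ i m ^ 2 ≤ G ^ 2 :=
    fun z S₀ hz hkick N hN =>
      (initialTail_le_of_clauses P hw0 hr0 (capture_of_inTubeWith_le P hn hζ0 hη0 hk₁ hr0 hz).2 hkick
        (j := kB) (by omega) hN (hΩ₁ N hN)).trans hGΩ₁
  have hdev := devProfile_of_conditionalBlock_ball P hε hε₀ hLB hGpos hℓb hVtop hBL hblock hVt hinit hcloseA hι hBLrow
    hcloseB hZb hZa hDb hDa
  -- the state bound and the flow bound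
  set Bst : ℝ := max (Ωw * (9 / 8 * r)) (ΩK * (Mζ + P.η n + r)) with hBst
  refine ⟨max Bst (MZω + DΩ), fun z S₀ hz hkick => ⟨fun i k => ?_, fun s hs hsc S F hS t ht i k => ?_⟩⟩
  · obtain ⟨hcap, hA⟩ := capture_of_inTubeWith_le P hn hζ0 hη0 hk₁ hr0 hz
    have hwk := hw0 k
    have hkk : |S₀ i k - z i k| ≤ r / w k := by rw [le_div_iff₀ hwk, mul_comm]; exact hkick i k
    have htri : |S₀ i k| ≤ |S₀ i k - z i k| + |z i k| := by
      have := abs_add_le (S₀ i k - z i k) (z i k); rwa [sub_add_cancel] at this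
    refine le_trans ?_ (le_max_left _ _)
    rcases lt_or_ge k (P.k₁ : ℤ) with hk | hk
    · -- below `k₁`: capture ball + kick (w ≥ 1)
      have hz1 : |z i k| ≤ Mζ + P.η n := by
        have h1 := hcap i k
        have := abs_sub_abs_le_abs_sub (z i k) (ζ n i k)
        linarith [hMζ i k hk]
      have hr1 : r / w k ≤ r := div_le_self hr0 (hw1 k)
      calc ω k * |S₀ i k| ≤ ΩK * (Mζ + P.η n + r) :=
            mul_le_mul (hωK k hk) (by linarith) (abs_nonneg _) hΩK
        _ ≤ Bst := le_max_right _ _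
    · -- ahead of `k₁`: both tails
      have hz1 : |z i k| ≤ r / (8 * w k) := by
        rw [le_div_iff₀ (by positivity)]; have := hA i k hk; linarith
      have hS : |S₀ i k| ≤ 9 / 8 * r / w k := by
        have e : r / w k + r / (8 * w k) = 9 / 8 * r / w k := by field_simp; ring
        linarith
      calc ω k * |S₀ i k| ≤ Ωw * w k * (9 / 8 * r / w k) := mul_le_mul (hωw k) hS (abs_nonneg _) (by positivity)
        _ = Ωw * (9 / 8 * r) := by field_simp
        _ ≤ Bst := le_max_left _ _
  · have hd := hdev z S₀ s S F hz hkick hs hsc hS t ht i k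
    have hZ := hZω i k t ⟨ht.1, ht.2.trans hsc⟩
    have htri := abs_sub_abs_le_abs_sub (S i k t) (Z i k t)
    have h1 : ω k * |S i k t| ≤ ω k * |Z i k t| + ω k * Dk k := by nlinarith [hω0 k]
    linarith [hωD k, le_max_right Bst (MZω + DΩ)]

end Block

end Summit.NavierStokesRegularity.NavierStokesRegularity.Theorems.HopTube

end
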